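import Mathlib
import Literature.AlgebraicGeometry.Resolution.Henselization
import Literature.AlgebraicGeometry.Resolution.HenselizedFunctionFields
import Summits.ResolutionOfSingularities.ResolutionOfSingularities.Theorems.DefectlessFramesDefectlessFramesRTwist
import Summits.ResolutionOfSingularities.ResolutionOfSingularities.Theorems.DefectlessFramesDefectlessFramesRSmallAxis
import Summits.ResolutionOfSingularities.ResolutionOfSingularities.Theorems.DefectlessFramesDefectlessFramesRFrameOfAxisDropAt

/-!
# Frames in a rational unit chart (crux stmt-ResolutionOfSingularities-17921, helper stub `stub_dfrRationalUnitChart`)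

Line `Sketch`, kernel analysis. If `K = k(u)` is generated over `k` by `n` algebraically independent elements
`u_i` of the rank-one zero-dimensional place `O ⊇ k`, and the hypersurface frame `(y; z; f)` lies in the chart
`k[u][1/g]` for some `g ∈ k[u]` of value `1` (a unit of `O`), then `(y; z; f)` is dominated by the frame
`(u; g⁻¹; G·X_n - 1)` (`G ∈ k[X_0..X_{n-1}]` with `G(u) = g`), which is in general position with axis polynomial
`ḡ·X - 1` of axis order `1 < p`; so the pointwise axis drop `stub_dfrFrameOfAxisDropAt` yields the conclusion of
the crux for `(y; z; f)`. The one algebraic input is the computation of the kernel of `k[X_0..X_n] → K`,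
`X_i ↦ u_i`, `X_n ↦ g⁻¹`: it is generated by `G·X_n - 1`, because `k[X_0..X_{n-1}][X]/(G·X - 1)` is the
localization of `A = k[X_0..X_{n-1}]` away from `G` and `A → K` is injective.
-/

namespace Summit.ResolutionOfSingularities.ResolutionOfSingularities.Theorems

open Literature.AlgebraicGeometry.Resolution IsLocalRing MvPolynomial Polynomial

/-- If `φ : A → L` is injective (`A` a domain), `G ≠ 0` and `φ(G)·b = 1`, then every `Q ∈ A[X]` with
`Q(b) = 0` (coefficients mapped by `φ`) is divisible by `G·X - 1`: the induced map from
`A[X]/(G·X - 1) = A[1/G]` to `L` is injective. [folklore] -/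
theorem dfrRatUnit_dvd_of_eval₂_eq_zero {A L : Type*} [CommRing A] [IsDomain A] [CommRing L]
    (φ : A →+* L) (hφ : Function.Injective φ) (G : A) (hG : G ≠ 0) (b : L) (hb : φ G * b = 1)
    (Q : A[X]) (hQ : Q.eval₂ φ b = 0) : (Polynomial.C G * Polynomial.X - 1) ∣ Q := by
  haveI := IsLocalization.adjoin_inv G
  have hroot : (Polynomial.C G * Polynomial.X - 1).eval₂ φ b = 0 := by simp [hb]
  have hψ : Function.Injective (AdjoinRoot.lift φ b hroot) := by
    rw [IsLocalization.injective_iff_map_algebraMap_eq (Submonoid.powers G)]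
    intro x y
    rw [AdjoinRoot.algebraMap_eq, AdjoinRoot.lift_of, AdjoinRoot.lift_of]
    constructor
    · intro h
      rw [← AdjoinRoot.algebraMap_eq] at h
      rw [IsLocalization.injective (M := Submonoid.powers G) (AdjoinRoot (Polynomial.C G * Polynomial.X - 1))
        (powers_le_nonZeroDivisors_of_noZeroDivisors hG) h]
    · intro h
      rw [hφ h]
  rw [← AdjoinRoot.mk_eq_zero]
  apply hψ
  rw [map_zero, AdjoinRoot.lift_mk, hQ]

/-- Evaluation of a polynomial over `k` at elements of a subring `O ⊇ k` of `K`, computed in `O`, agrees with the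
evaluation in `K`. [folklore] -/
theorem dfrRatUnit_coe_eval₂ {k K : Type*} [Field k] [Field K] [Algebra k K] (O : ValuationSubring K)
    (hk : ∀ c : k, algebraMap k K c ∈ O) {σ : Type*} (w : σ → O) (P : MvPolynomial σ k) :
    ((MvPolynomial.eval₂ ((algebraMap k K).codRestrict O hk) w P : O) : K)
      = MvPolynomial.aeval (fun i => (w i : K)) P := by
  rw [MvPolynomial.aeval_def, show ((MvPolynomial.eval₂ ((algebraMap k K).codRestrict O hk) w P : O) : K)
      = O.subtype (MvPolynomial.eval₂ ((algebraMap k K).codRestrict O hk) w P) from rfl,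
    MvPolynomial.eval₂_comp_left]
  rfl

/-- The root multiplicity of `c'` in `c·X - 1` is `1` when `c·c' = 1` (over a domain). [folklore] -/
theorem dfrRatUnit_rootMultiplicity_C_mul_X_sub_one {κ : Type*} [CommRing κ] [IsDomain κ] (c c' : κ)
    (h : c * c' = 1) :
    (Polynomial.C c * Polynomial.X - 1 : κ[X]) ≠ 0 ∧
      (Polynomial.C c * Polynomial.X - 1 : κ[X]).rootMultiplicity c' = 1 := by
  have hfac : (Polynomial.C c * Polynomial.X - 1 : κ[X]) = Polynomial.C c * (Polynomial.X - Polynomial.C c') := by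
    rw [mul_sub, ← Polynomial.C_mul, h, Polynomial.C_1]
  have hc : c ≠ 0 := left_ne_zero_of_mul_eq_one h
  have hne : (Polynomial.C c * (Polynomial.X - Polynomial.C c') : κ[X]) ≠ 0 :=
    mul_ne_zero (Polynomial.C_ne_zero.mpr hc) (Polynomial.X_sub_C_ne_zero c')
  refine ⟨hfac ▸ hne, ?_⟩
  rw [hfac, Polynomial.rootMultiplicity_mul hne, Polynomial.rootMultiplicity_C,
    Polynomial.rootMultiplicity_X_sub_C_self, zero_add]


/-- **Frames in a rational unit chart** (helper stub `stub_dfrRationalUnitChart`, crux `DefectlessFramesR`, line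
`Sketch`). If `K = k(u)` with `u : Fin n → O` algebraically independent and the frame `(y; z; f)` lies in
`k[u][1/g]` for some `g ∈ k[u]` with `v(g) = 0`, then the conclusion of the crux holds for `(y; z; f)`: it is
dominated by the general-position frame `(u; g⁻¹; G·X_n - 1)` of axis order `1 < p`, and
`stub_dfrFrameOfAxisDropAt` applies. [folklore] -/
theorem stub_dfrRationalUnitChart : ∀ p : ℕ, p.Prime → ∀ (k K : Type) [Field k] [CharP k p] [PerfectField k] [Field K] [Algebra k K], (⊤ : IntermediateField k K).FG → ∀ O : ValuationSubring K, ∀ hk : (∀ c : k, algebraMap k K c ∈ O), Nonempty O.valuation.RankOne → (∀ x ∈ O, ∃ f : Polynomial k, f ≠ 0 ∧ Polynomial.aeval x f ∈ O.nonunits) → let ρ : k →+* IsLocalRing.ResidueField O := (IsLocalRing.residue O).comp ((algebraMap k K).codRestrict O hk); let axis : (m : ℕ) → (Fin m → O) → MvPolynomial (Fin (m + 1)) k → Polynomial (IsLocalRing.ResidueField O) := fun _ w g => MvPolynomial.eval₂ (Polynomial.C.comp ρ) (Fin.snoc (fun j => Polynomial.C (IsLocalRing.residue O (w j))) Polynomial.X)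 g; ∀ (n : ℕ) (y : Fin n → O) (z : O) (f : MvPolynomial (Fin (n + 1)) k), AlgebraicIndependent k (fun i => (y i : K)) → IntermediateField.adjoin k (Set.range (fun i => (y i : K)) ∪ {(z : K)}) = ⊤ → Ideal.span {f} = RingHom.ker (MvPolynomial.aeval (Fin.snoc (fun i => (y i : K)) (z : K)) : MvPolynomial (Fin (n + 1)) k →ₐ[k] K) → f ≠ 0 → (∃ (u : Fin n → O) (g : K), AlgebraicIndependent k (fun i => (u i : K)) ∧ IntermediateField.adjoin k (Set.range fun i => (u i : K)) = ⊤ ∧ g ∈ Algebra.adjoin k (Set.range fun i => (u i : K)) ∧ O.valuation g = 1 ∧ (∀ i, (y i : K) ∈ Algebra.adjoin k (Set.range (fun i => (u i : K)) ∪ {g⁻¹})) ∧ (z : K) ∈ Algebra.adjoin k (Set.range (fun i => (u i : K)) ∪ {g⁻¹})) → ∃ (y' : Fin n → O) (z' : O) (f' : MvPolynomial (Fin (n + 1)) k), AlgebraicIndependent k (fun i => (y' i : K)) ∧ IsIntegral (Algebra.adjoin k (Set.range fun i => (y' i : K))) (z' : K) ∧ IntermediateField.adjoin k (Set.range (fun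 i => (y' i : K)) ∪ {(z' : K)}) = ⊤ ∧ Ideal.span {f'} = RingHom.ker (MvPolynomial.aeval (Fin.snoc (fun i => (y' i : K)) (z' : K)) : MvPolynomial (Fin (n + 1)) k →ₐ[k] K) ∧ (∀ i, (y i : K) ∈ Algebra.adjoin k (Set.range (fun i => (y' i : K)) ∪ {(z' : K)})) ∧ (z : K) ∈ Algebra.adjoin k (Set.range (fun i => (y' i : K)) ∪ {(z' : K)}) ∧ axis n y' f' ≠ 0 ∧ (axis n y f ≠ 0 → (axis n y' f').rootMultiplicity (IsLocalRing.residue O z') ≤ (axis n y f).rootMultiplicity (IsLocalRing.residue O z)) ∧ IsSeparable (IntermediateField.adjoin k (Set.range fun i => (y' i : K))) (z' : K) ∧ ∀ (Ω : Type) [Field Ω] [Algebra K Ω] [IsAlgClosure K Ω] (V : ValuationSubring Ω), V.comap (algebraMap K Ω) = O → let F : Subfield Ω := (IntermediateField.adjoin k (Set.range fun i => (y' i : K))).toSubfield.map (algebraMap K Ω); Literature.AlgebraicGeometry.Resolution.IsDefectlessExtension V (Literature.AlgebraicGeometry.Resolution.henselization V F) (Literature.AlgebraicGeometry.Resolution.henselization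 V F ⊔ (algebraMap K Ω).fieldRange) := by
  intro p hp k K _ _ _ _ _ hfg O hk hR hZ ρ axis n y z f hy hadj hker hf hex
  obtain ⟨u, g, hu, hutop, hgmem, hvg, hdomy, hdomz⟩ := hex
  classical
  -- constants into `O`
  set ι : k →+* O := (algebraMap k K).codRestrict O hk with hι
  have hρ : ρ = (IsLocalRing.residue O).comp ι := rfl
  -- (1) `g` is a unit of `O`; the new last coordinate `z₂ = g⁻¹`
  have hg0 : g ≠ 0 := by
    rintro rfl
    rw [map_zero] at hvg
    exact zero_ne_one hvg
  have hgO : g ∈ O := (O.valuation_le_one_iff g).mp hvg.le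
  have hginvO : g⁻¹ ∈ O := (O.valuation_le_one_iff g⁻¹).mp (by rw [map_inv₀, hvg, inv_one])
  set gO : O := ⟨g, hgO⟩ with hgOdef
  set z₂ : O := ⟨g⁻¹, hginvO⟩ with hz₂def
  have hmul : gO * z₂ = 1 := Subtype.ext (mul_inv_cancel₀ hg0)
  have hres : IsLocalRing.residue O gO * IsLocalRing.residue O z₂ = 1 := by
    rw [← map_mul, hmul, map_one]
  -- (2) `G ∈ k[X_0..X_{n-1}]` with `G(u) = g`
  have hgmem' := hgmem
  rw [Algebra.adjoin_range_eq_range_aeval, AlgHom.mem_range] at hgmem'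
  obtain ⟨G, hG⟩ := hgmem'
  set φ : MvPolynomial (Fin n) k →+* K := MvPolynomial.eval₂Hom (algebraMap k K) (fun i => (u i : K)) with hφ
  have hφG : φ G = g := hG
  have hφinj : Function.Injective φ := algebraicIndependent_iff_injective_aeval.mp hu
  have hG0 : G ≠ 0 := by
    rintro rfl
    rw [map_zero] at hφG
    exact hg0 hφG.symm
  have hfz : MvPolynomial.aeval (Fin.snoc (fun i => (y i : K)) (z : K)) f = 0 := by
    rw [← RingHom.mem_ker, ← hker]
    exact Ideal.mem_span_singleton_self f
  -- (3) the relation `f₂ = G·X_n - 1` and its image `G·X - 1` in `A[X]`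
  set f₂ : MvPolynomial (Fin (n + 1)) k :=
    MvPolynomial.rename Fin.castSucc G * MvPolynomial.X (Fin.last n) - 1 with hf₂
  have hef₂ : ((MvPolynomial.renameEquiv k finSuccEquivLast).trans (MvPolynomial.optionEquivLeft k (Fin n))) f₂
      = Polynomial.C G * Polynomial.X - 1 := by
    rw [hf₂, map_sub, map_mul, map_one, dfrTwist_fin_rename_castSucc, dfrTwist_fin_X_last]
  have heval : ∀ P : MvPolynomial (Fin (n + 1)) k,
      MvPolynomial.aeval (Fin.snoc (fun i => (u i : K)) (z₂ : K)) P
        = (((MvPolynomial.renameEquiv k finSuccEquivLast).trans (MvPolynomial.optionEquivLeft k (Fin n))) P).eval₂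
            φ g⁻¹ := fun P => by
    rw [MvPolynomial.aeval_def, hφ, dfrTwist_eval₂_fin]
  have hf₂0 : MvPolynomial.aeval (Fin.snoc (fun i => (u i : K)) (z₂ : K)) f₂ = 0 := by
    rw [heval, hef₂]
    simp [hφG, hg0]
  -- (4) the kernel of `X_i ↦ u_i, X_n ↦ g⁻¹` is `(f₂)`
  have hker₂ : Ideal.span {f₂} = RingHom.ker (MvPolynomial.aeval (Fin.snoc (fun i => (u i : K)) (z₂ : K)) :
      MvPolynomial (Fin (n + 1)) k →ₐ[k] K) := by
    refine le_antisymm ?_ fun P hP => ?_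
    · rw [Ideal.span_le, Set.singleton_subset_iff, SetLike.mem_coe, RingHom.mem_ker]
      exact hf₂0
    · rw [RingHom.mem_ker, heval] at hP
      rw [Ideal.mem_span_singleton]
      have hdvd := map_dvd ((MvPolynomial.renameEquiv k finSuccEquivLast).trans
        (MvPolynomial.optionEquivLeft k (Fin n))).symm
        (dfrRatUnit_dvd_of_eval₂_eq_zero φ hφinj G hG0 g⁻¹ (by rw [hφG, mul_inv_cancel₀ hg0]) _ hP)
      rwa [← hef₂, AlgEquiv.symm_apply_apply, AlgEquiv.symm_apply_apply] at hdvd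
  -- (5) `f₂ ≠ 0`
  have hf₂ne : f₂ ≠ 0 := by
    intro h
    have h1 := congrArg ((MvPolynomial.renameEquiv k finSuccEquivLast).trans
      (MvPolynomial.optionEquivLeft k (Fin n))) h
    rw [hef₂, map_zero] at h1
    have h2 := congrArg (Polynomial.eval 0) h1
    simp at h2
  -- (6) `k(u, g⁻¹) = K`
  have hadj₂ : IntermediateField.adjoin k (Set.range (fun i => (u i : K)) ∪ {(z₂ : K)}) = ⊤ := by
    rw [eq_top_iff, ← hutop]
    exact IntermediateField.adjoin.mono k _ _ Set.subset_union_left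
  -- (8) the axis polynomial of the new frame is `ḡ·X - 1`
  have hGO : MvPolynomial.eval₂Hom ι u G = gO := by
    apply Subtype.val_injective
    show ((MvPolynomial.eval₂ ι u G : O) : K) = g
    rw [hι, dfrRatUnit_coe_eval₂]
    exact hG
  have hGres : MvPolynomial.eval₂Hom ρ (fun j => IsLocalRing.residue O (u j)) G = IsLocalRing.residue O gO := by
    rw [← hGO, MvPolynomial.coe_eval₂Hom, MvPolynomial.coe_eval₂Hom, MvPolynomial.eval₂_comp_left]
    rfl
  have hax₂ : axis n u f₂ = Polynomial.C (IsLocalRing.residue O gO) * Polynomial.X - 1 := by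
    show MvPolynomial.eval₂ (Polynomial.C.comp ρ)
      (Fin.snoc (fun j => Polynomial.C (IsLocalRing.residue O (u j))) Polynomial.X) f₂ = _
    rw [dfrTwist_axis_eq_map, hef₂, Polynomial.map_sub, Polynomial.map_mul, Polynomial.map_C,
      Polynomial.map_X, Polynomial.map_one, hGres]
  obtain ⟨hax₂0, hmult⟩ := dfrRatUnit_rootMultiplicity_C_mul_X_sub_one _ _ hres
  rw [← hax₂] at hax₂0 hmult
  -- (9) the axis order of `(y; z; f)` is at least `1` (`z̄` is a root of the axis polynomial)
  have h9 : axis n y f ≠ 0 → (axis n u f₂).rootMultiplicity (IsLocalRing.residue O z₂) ≤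
      (axis n y f).rootMultiplicity (IsLocalRing.residue O z) := by
    intro hax
    rw [hmult]
    refine (Polynomial.rootMultiplicity_pos hax).mpr ?_
    have h0 : MvPolynomial.eval₂ ι (Fin.snoc y z) f = 0 := by
      apply Subtype.val_injective
      rw [hι, dfrRatUnit_coe_eval₂]
      have : (fun i => ((Fin.snoc y z : Fin (n + 1) → O) i : K)) = Fin.snoc (fun i => (y i : K)) (z : K) := by
        funext i
        refine Fin.lastCases ?_ (fun j => ?_) i <;> simp
      rw [this, hfz]
      rfl
    have h1 := congrArg (IsLocalRing.residue O) h0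
    rw [map_zero, MvPolynomial.eval₂_comp_left, ← hρ, Fin.comp_snoc] at h1
    show Polynomial.eval (IsLocalRing.residue O z) (MvPolynomial.eval₂ (Polynomial.C.comp ρ)
      (Fin.snoc (fun j => Polynomial.C (IsLocalRing.residue O (y j))) Polynomial.X) f) = 0
    rw [dfrTwist_axis_eq_map, Polynomial.eval_map, dfrTwist_eval₂_fin]
    exact h1
  -- (10) conclude by the pointwise axis drop
  exact stub_dfrFrameOfAxisDropAt p hp k K hfg O hk hR hZ n y z f hy hadj hker hf
    ⟨u, z₂, f₂, hu, hadj₂, hker₂, hf₂ne, hdomy, hdomz, hax₂0, by rw [hmult]; exact hp.one_lt, h9⟩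

end Summit.ResolutionOfSingularities.ResolutionOfSingularities.Theorems
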